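import Summits.AtomisticToContinuum.Crystallization.Theorems.ExcessDecayLiouvillePhononStabilityLatticeSum
import Summits.AtomisticToContinuum.Crystallization.Theorems.ExcessDecayLiouvillePhononStabilityLabels
import Summits.AtomisticToContinuum.Crystallization.Theorems.ExcessDecayLiouvillePhononStabilityPullback
import Summits.AtomisticToContinuum.Crystallization.Theorems.ExcessDecayLiouvillePhononStabilityWindow
import Summits.AtomisticToContinuum.Crystallization.Theorems.ExcessDecayLiouvillePhononStabilityFarDefs
import Summits.AtomisticToContinuum.Crystallization.Theorems.ExcessDecayLiouvillePhononStabilityChainBound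
import Summits.AtomisticToContinuum.Crystallization.Theorems.ExcessDecayLiouvillePhononStabilityPathBound
import Summits.AtomisticToContinuum.Crystallization.Theorems.ExcessDecayLiouvillePhononStabilityLatticeCount
import Summits.AtomisticToContinuum.Crystallization.Theorems.ExcessDecayLiouvillePhononStabilityTailSum
import Summits.AtomisticToContinuum.Crystallization.Theorems.ExcessDecayLiouvillePhononStabilityFarControl
import Summits.AtomisticToContinuum.Crystallization.Theorems.ExcessDecayLiouvillePhononStabilityCertChart
import Summits.AtomisticToContinuum.Crystallization.Theorems.ExcessDecayLiouvillePhononStabilityCertRange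
import Summits.AtomisticToContinuum.Crystallization.Theorems.ExcessDecayLiouvillePhononStabilityCertMetric
import Summits.AtomisticToContinuum.Crystallization.Theorems.ExcessDecayLiouvillePhononStabilityCertPsi
import Summits.AtomisticToContinuum.Crystallization.Theorems.ExcessDecayLiouvillePhononStabilityCertRangeSum
import Summits.AtomisticToContinuum.Crystallization.Theorems.ExcessDecayLiouvillePhononStabilityCertCharge
import Summits.AtomisticToContinuum.Crystallization.Theorems.ExcessDecayLiouvillePhononStabilityCertCover
import Summits.AtomisticToContinuum.Crystallization.Theorems.ExcessDecayLiouvillePhononStabilityCertNear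
import Summits.AtomisticToContinuum.Crystallization.Theorems.ExcessDecayLiouvillePhononStabilityVtxDefs
import Summits.AtomisticToContinuum.Crystallization.Theorems.ExcessDecayLiouvillePhononStabilityCertSymmHcp
import Summits.AtomisticToContinuum.Crystallization.Theorems.ExcessDecayLiouvillePhononStabilityCertInterp
import Summits.AtomisticToContinuum.Crystallization.Theorems.ExcessDecayLiouvillePhononStabilityCertBlochDefs

/-!
# Line `contragredient-window-collapse` for crux `ExcessDecayLiouville.PhononStability`
# (item stmt-AtomisticToContinuum-9333) — LEAD SKELETON v10 (prover-line-stmt-AtomisticToContinuum-9333-c3-0)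

Crux (concluded BY NAME by `PhononStability_of` at the bottom):
`Summit.AtomisticToContinuum.Crystallization.Theses.ExcessDecayLiouville.PhononStability`.

v10 (RESHAPE of the lower half of the near certificate, lead c3, 2026-08-17).  Lead c2's v8/v9 box-grid vertex scheme in
the 9-dim chart `(Ĝ, δ̂)` cannot close as a box grid (c2, 14:58Z: chart-box corners outside the spectral band are
Bloch-unstable; thin model margin at the dilated edge).  v10 keeps everything landed (far field S0–S10, symmetry to the
fundamental domain, the model/chart/curvature/interpolation/PSD layers) and changes two things:

* **B5 spectral corners (exact collapse of the 6 metric dimensions).**  With the tangent minorant of the convex `ω̃`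
  (`CertConvex`) and the constant dual-metric majorant `H⁺ ⪰ Ĥ` in the `ψ`/`κ` terms, the lower model of the near form
  is CONCAVE in `Ĝ` on the convex metric window `Kmetric = {a²M₀ ⪯ Ĝ ⪯ b²M₀}`; by `SpectralCornerPrinciple`
  (`stub_spectralCorner`, analytic: simultaneous diagonalisation of `(Ĝ, M₀)` + concavity on the eigenvalue cube) it
  is enough to certify it at `Ĝ ∈ {a²M₀, b²M₀} ∪ {(m+ε)M₀ − 2εppᵀ} ∪ {(m−ε)M₀ + 2εppᵀ}` (`pᵀM₀⁻¹p = 1`): two points and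
  two 2-parameter families — no cell vertex ever leaves the window, and only `(p, δ̂)` (2 + 3 dims) is gridded.
* **B1–B4 Bloch discharge of the nodes (human certificate objective: Hermitian eigen-enclosures).**  A node obligation
  is `PairFormNonneg L` for a RATIONAL pair-table list `L`; `BlochReduction` (`stub_blochReduction`, analytic:
  finite-torus Plancherel) reduces it to `SymbolPSD L` (the 6×6 Hermitian symbol form is `≥ 0` on the phase torus),
  which is certified natively: exact rational evaluation at tangent-half-angle grid points with an integer PSD test
  (`CertBlochPoint`, registered `stub_certBlochPoint`), second-order θ-box interpolation with the slice-curvature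
  constants `curvQ` (`CertBlochCurv`, `stub_certBlochCurv`; `ge_min_vertices_sub` of `CertInterp`), the two-chart
  tangent half-angle cover of the circle (`CertBlochArc`, `stub_certBlochArc`), and the acoustic blow-up at `θ = 0`.
  Exact criterion — no sum-of-squares representability gap, no Gram data.
* `stub_nearResidual` (THE HARDEST STUB, to be reshaped into the assembly B6 + the computational node stub B7 once
  the `(p, δ̂)`-chart vocabulary lands): from B1 and B5, the near certificate on the fundamental domain.

Every far-field stub is LANDED and imported (S0, S1a, S1b, S2, S6–S10); `composition5`/`PhononStability_of` are
sorry-free; the sorries are exactly `stub_blochReduction`, `stub_spectralCorner`, `stub_nearResidual`.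
(A parallel strategist line `bloch-symbol-window` (r1, 18:30Z) cuts at the same place on the Fourier side with REAL
class matrices; B1 here is its `stub_bloch` specialised to rational tables and phases on the unit torus.)
-/



noncomputable section

open scoped BigOperators Classical InnerProductSpace
open Filter Set Function
open Literature.MathematicalPhysics.StatisticalMechanics
open Summit.AtomisticToContinuum.Crystallization.Theses.ExcessDecayLiouville
open Summit.AtomisticToContinuum.Crystallization.Theorems.PhononStabilityNegative
open Summit.AtomisticToContinuum.Crystallization.Theorems.PhononStabilityCWC
open Summit.AtomisticToContinuum.Crystallization.Theorems.PhononStabilityCWC.Cert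


namespace Summit.AtomisticToContinuum.Crystallization.Cruxes.PhononStability.ContragredientWindowCollapse

local notation "E3" => EuclideanSpace ℝ (Fin 3)

/-! ## Elementary API used by the composition (proved) -/

/-- The metric functional of a diagonal class vanishes. [folklore] -/
theorem metricForm_diag (B : E3 →L[ℝ] E3) (w : Label → E3) {c : BondClass} (hc : diagClass c) :
    metricForm B c w = 0 := by
  obtain ⟨m, m', n⟩ := c
  obtain ⟨h1, h2⟩ := hc
  simp only at h1 h2
  subst h1; subst h2
  simp [metricForm, bondDiff]

/-- Bond-graph constancy turns the metric cut-off of `Nform` into the finite nearest-neighbour sum. [folklore] -/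
theorem Nform_eq_sum {A B : E3 →L[ℝ] E3} {δ : E3} {w : Label → E3}
    (hgraph : ∀ c : BondClass, ¬ diagClass c → (c ∈ nnClasses ↔ ‖A (bondVec δ c)‖ ≤ 11 / 10)) :
    Nform A B δ w = ∑ c ∈ nnClasses, metricForm B c w := by
  have key : ∀ c : BondClass, (if ‖A (bondVec δ c)‖ ≤ 11 / 10 then metricForm B c w else 0) =
      if c ∈ nnClasses then metricForm B c w else 0 := by
    intro c
    by_cases hd : diagClass c
    · simp [metricForm_diag B w hd]
    · by_cases hc : c ∈ nnClasses
      · rw [if_pos ((hgraph c hd).1 hc), if_pos hc]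
      · rw [if_neg (fun h => hc ((hgraph c hd).2 h)), if_neg hc]
  unfold Nform
  rw [tsum_congr key, tsum_eq_sum (s := nnClasses) (fun c hc => if_neg hc)]
  exact Finset.sum_congr rfl fun c hc => if_pos hc

/-- Splitting `Hform` at range `R`: finite part plus far `tsum`, for a summable class family. [folklore] -/
theorem Hform_eq_sum_add_tsum {A B : E3 →L[ℝ] E3} {δ : E3} {w : Label → E3} (R : ℝ)
    (hs : Summable (classTerm A B δ w)) :
    Hform A B δ w = (∑ c ∈ classesR R, classTerm A B δ w c) +
      ∑' c, if c ∈ classesR R then 0 else classTerm A B δ w c := by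
  unfold Hform
  have h1 : (fun c => classTerm A B δ w c) =
      fun c => (if c ∈ classesR R then classTerm A B δ w c else 0) +
        (if c ∈ classesR R then 0 else classTerm A B δ w c) := by
    funext c; split_ifs <;> simp
  have hfin : Summable fun c => if c ∈ classesR R then classTerm A B δ w c else 0 :=
    summable_of_hasFiniteSupport ((classesR R).finite_toSet.subset (by
      intro c hc; by_contra h; exact hc (if_neg h)))
  have hfar : Summable fun c => if c ∈ classesR R then 0 else classTerm A B δ w c := by
    have : (fun c => if c ∈ classesR R then 0 else classTerm A B δ w c) =
        fun c => classTerm A B δ w c - if c ∈ classesR R then classTerm A B δ w c else 0 := by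
      funext c; split_ifs <;> simp
    rw [this]; exact hs.sub hfin
  rw [show (∑' c, classTerm A B δ w c) = ∑' c, ((if c ∈ classesR R then classTerm A B δ w c else 0) +
      (if c ∈ classesR R then 0 else classTerm A B δ w c)) from by rw [← h1], hfin.tsum_add hfar,
    tsum_eq_sum (s := classesR R) (fun c hc => if_neg hc)]
  congr 1
  exact Finset.sum_congr rfl fun c hc => if_pos hc

/-! ## Registered stubs (v10): nine landed (aliases), THREE open -/

/-- S0 — LANDED (`Theorems/ExcessDecayLiouvillePhononStabilityLatticeSum.lean`, p94846). -/
theorem stub_latticeSum : LatticeSum := LatticeSumStub.stub_latticeSum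

/-- S1a — LANDED (`Theorems/ExcessDecayLiouvillePhononStabilityLabels.lean`, p91918). -/
theorem stub_labels : LabelModel := LabelsStub.stub_labels

/-- S1b — LANDED (`Theorems/ExcessDecayLiouvillePhononStabilityPullback.lean`, p94865; per-bond part p92825). -/
theorem stub_pullback : PullbackReduction := PullbackStub.stub_pullback

/-- S2 — LANDED (`Theorems/ExcessDecayLiouvillePhononStabilityWindow.lean`, p93342). -/
theorem stub_window : WindowGeometry := WindowStub.stub_window

/-- S6 — LANDED (`Theorems/ExcessDecayLiouvillePhononStabilityChainBound.lean`). -/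
theorem stub_chainBound : ChainBound := ChainBoundStub.stub_chainBound

/-- S7 — LANDED (`Theorems/ExcessDecayLiouvillePhononStabilityPathBound.lean`). -/
theorem stub_pathBound : PathBound := PathBoundStub.stub_pathBound

/-- S8 — LANDED (`Theorems/ExcessDecayLiouvillePhononStabilityLatticeCount.lean`). -/
theorem stub_latticeCount : LatticeCount := LatticeCountStub.stub_latticeCount

/-- S9 — LANDED (`Theorems/ExcessDecayLiouvillePhononStabilityTailSum.lean`). -/
theorem stub_tailSum : TailSum := TailSumStub.stub_tailSum

/-- S10 — LANDED (`Theorems/ExcessDecayLiouvillePhononStabilityFarControl.lean`). -/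
theorem stub_farControl : FarControl := FarControlStub.stub_farControl

/-- B1 — BLOCH REDUCTION (analytic, L): PSD symbol on the torus ⇒ nonnegative pair form, for rational pair tables.
OPEN (v10, wave 1). -/
theorem stub_blochReduction : BlochReduction := by
  sorry

/-- B5 — SPECTRAL CORNER PRINCIPLE (analytic, M): concave on `Kmetric` + nonnegative on `cornerSet` ⇒ nonnegative on
`Kmetric`.  OPEN (v10, wave 1). -/
theorem stub_spectralCorner : SpectralCornerPrinciple := by
  sorry

/-- The residual of v10: the near certificate on the fundamental domain FROM the Bloch reduction and the spectral
corner principle (assembly of the `(p, δ̂)` cells, the concave lower model, the node tables and their native symbol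
checks).  To be reshaped into registered layers B6/B7. [folklore] -/
def NearResidualV10 : Prop := BlochReduction → SpectralCornerPrinciple → NearCertificateF

/-- B6/B7 — THE HARDEST STUB (assembly + computational): `NearResidualV10`.  OPEN (lead c3). -/
theorem stub_nearResidual : NearResidualV10 := by
  sorry

/-- S11-F — the near certificate on the in-plane fundamental domain, from the three v10 stubs (no sorry of its own). -/
theorem stub_nearF : NearCertificateF := stub_nearResidual stub_blochReduction stub_spectralCorner

/-! ## The kernel-checked composition (v4) -/

/-- `Σ_k ‖Δ_c w k‖² ≥ 0`. [folklore] -/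
theorem plainForm_nonneg (c : BondClass) (w : Label → E3) : 0 ≤ plainForm c w :=
  tsum_nonneg fun _ => by positivity

/-- `N0 ≥ 0`. [folklore] -/
theorem N0_nonneg (w : Label → E3) : 0 ≤ N0 w :=
  Finset.sum_nonneg fun c _ => plainForm_nonneg c w

/-- **Pure logic of the reshaped line** (no sorry, no stub used): label model and pull-back at the datum;
split `Hform` at range `Rn`; far control on `(Rn, ∞)`; tail sum; near certificate. -/
theorem composition4 (h0 : LatticeSum) (h1a : LabelModel) (h1 : PullbackReduction) (h2 : WindowGeometry)
    (hC : ChainBound) (hP : PathBound) (hL : LatticeCount) (hT : TailSum) (hF : FarControl)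
    (hN : NearCertificate) :
    PhononStabilityOn fun t A => Adm₀ A ∧ Inner₀ t A := by
  obtain ⟨κ, hκ, Rn, Rf, Rinf, chain, P, hRn, hRnf, hRfi, hRinf, hvalid, hmid, hnear⟩ := hN
  refine ⟨κ, hκ, ?_⟩
  rintro t A ⟨hAdm, hInn⟩ u hu hsupp
  obtain ⟨B, δ, hW, hδ, hAB, hinj, hrange⟩ := h1a t A hAdm hInn
  obtain ⟨w, hw, hred⟩ := h1 t A B δ hW hδ hAB hinj hrange u hu hsupp
  have hls : LatticeSummable w := h0 w hw
  obtain ⟨hsum, hN, hH⟩ := hred hls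
  obtain ⟨hgraph, -, -, -⟩ := h2 A δ hW hδ
  have hNf : Nform A B δ w = ∑ c ∈ nnClasses, metricForm B c w := Nform_eq_sum hgraph
  have hsplit := Hform_eq_sum_add_tsum Rn hsum
  obtain ⟨hsumT, hTle⟩ := hT hL Rinf hRinf
  have hfar := hF hC hP Rn Rf Rinf hRn hRnf hRfi chain hvalid P hmid hsumT A B δ w hW hδ hw hls hsum
  have hnear' := hnear A B δ w hW hδ hAB hw
  have hN0 : 0 ≤ N0 w := N0_nonneg w
  have hRinf3 : 0 < Rinf ^ 3 := by positivity
  have htc : farTailConst Rinf * N0 w ≤ 40000 / Rinf ^ 3 * N0 w := mul_le_mul_of_nonneg_right hTle hN0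
  rw [hN, hH, hsplit, hNf]
  linarith [hfar, hnear', htc]

/-- **Pure logic of the reshaped line v8** (no sorry, no stub used): as `composition4`, on the window intersected with the
in-plane fundamental domain, from the near certificate on the fundamental domain. -/
theorem composition5 (h0 : LatticeSum) (h1a : LabelModel) (h1 : PullbackReduction) (h2 : WindowGeometry)
    (hC : ChainBound) (hP : PathBound) (hL : LatticeCount) (hT : TailSum) (hF : FarControl)
    (hN : NearCertificateF) :
    PhononStabilityOn fun t A => Adm₀ A ∧ Inner₀ t A ∧ inPlaneOrdered t A := by
  obtain ⟨κ, hκ, Rn, Rf, Rinf, chain, P, hRn, hRnf, hRfi, hRinf, hvalid, hmid, hnear⟩ := hN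
  refine ⟨κ, hκ, ?_⟩
  rintro t A ⟨hAdm, hInn, hOrd⟩ u hu hsupp
  obtain ⟨B, δ, hW, hδ, hAB, hinj, hrange⟩ := h1a t A hAdm hInn
  obtain ⟨w, hw, hred⟩ := h1 t A B δ hW hδ hAB hinj hrange u hu hsupp
  have hls : LatticeSummable w := h0 w hw
  obtain ⟨hsum, hN, hH⟩ := hred hls
  obtain ⟨hgraph, -, -, -⟩ := h2 A δ hW hδ
  have hNf : Nform A B δ w = ∑ c ∈ nnClasses, metricForm B c w := Nform_eq_sum hgraph
  have hsplit := Hform_eq_sum_add_tsum Rn hsum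
  obtain ⟨hsumT, hTle⟩ := hT hL Rinf hRinf
  have hfar := hF hC hP Rn Rf Rinf hRn hRnf hRfi chain hvalid P hmid hsumT A B δ w hW hδ hw hls hsum
  have hnear' := hnear A B δ w hW hδ hAB ⟨hOrd.1, hOrd.2⟩ hw
  have hN0 : 0 ≤ N0 w := N0_nonneg w
  have hRinf3 : 0 < Rinf ^ 3 := by positivity
  have htc : farTailConst Rinf * N0 w ≤ 40000 / Rinf ^ 3 * N0 w := mul_le_mul_of_nonneg_right hTle hN0
  rw [hN, hH, hsplit, hNf]
  linarith [hfar, hnear', htc]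

/-- **The line concludes the crux BY NAME** (v8: through the lattice symmetry to the fundamental domain). -/
theorem PhononStability_of :
    Summit.AtomisticToContinuum.Crystallization.Theses.ExcessDecayLiouville.PhononStability :=
  phononStability_iff_on.mpr
    (phononStabilityOn_of_inPlaneOrdered
      (composition5 stub_latticeSum stub_labels stub_pullback stub_window stub_chainBound stub_pathBound
        stub_latticeCount stub_tailSum stub_farControl stub_nearF))

end Summit.AtomisticToContinuum.Crystallization.Cruxes.PhononStability.ContragredientWindowCollapse

end
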